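import Mathlib
import Literature.MathematicalPhysics.QuantumLattice.HubbardBandSectorCountingToolbox
import Literature.MathematicalPhysics.QuantumLattice.ThinSectorFoldConvexWindow
import HarnessLib

/-!
# Four-sector counting, fold ranges: the ARCSINE SUM `Σ 1/√|D(σ)|` over the grid rows near a convex minimum of the diagonal function

Topic `Literature/MathematicalPhysics/QuantumLattice`; sub-namespace `BandSectorCounting` (generic one-variable calculus, continues
`ThinSectorFoldConvexWindow`).  Part (F3c-i) of the log-free ANISOTROPIC anchored four-sector counting lemma («E1-P2-THIN-COUNT», cell
gate-hubbard-kl, plan g17 (R41); seat p4; plan HOME/prover-p4/E1-P2-THIN-COUNT-PLAN.md §Refinement 4).  In the fold ranges the anti-aligned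
near-critical rows `σ` whose anti-diagonal fibre does cross the level (diagonal value `D(σ) < 0`) cost `≍ δ/(w√|D(σ)|)` cells each
(`gridCount_L5_affine`), with the FAT tolerance `δ ≍ w` at an umklapp corner; near a nondegenerate minimum `σ_c` of `D` (`D″ ≥ c₂` on a window,
critical value `D_c < 0`) the row sum `Σ_σ 1/√|D(σ)|` is a discrete arcsine integral, `O(1/h)` UNIFORMLY in `D_c` — no logarithm, whereas the
dyadic level counts of the isotropic lemma (`count_levels_diag`, `√η/w` rows per level) pay one.  This file is that sum as pure grid calculus:
the DEEP rows (`D ≤ D_c/2`) are `≤ 2√(|D_c|/c₂)/h + 1` many and cost `≤ √2/√|D_c|` each; on the SHALLOW rows (`D_c/2 < D ≤ −φ`) the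
tangent inequality of the convex `D` gives the slope `D′ ≥ √(c₂|D_c|/8)` (resp. `≤ −`), so consecutive shallow rows differ in `|D|` by
`≥ v·h` and the sum is `Σ_k (φ + v h k)^{-1/2} ≤ 1/√φ + 4/(√c₂ h)`:

* (private) `Σ_{k<K} 1/√(φ + v k) ≤ 1/√φ + 2√(K−1)/√v` and its rank form (`φ + v·r(i) ≤ a_i`, `r` injective into `{0,…,K−1}`);
* **`sum_inv_sqrt_near_min_le`** — `c₂ ≤ g″` on `[σ_c − R, σ_c + R]`, `g′(σ_c) = 0`, `0 < φ`:
  `Σ_{i<N : xᵢ ∈ window, g(xᵢ) ≤ −φ} 1/√|g(xᵢ)| ≤ 4/√φ + 11/(√c₂·h)` on any grid `xᵢ = x₀ + i·h`.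

Everything is PROVED; no definitions, no named facts.

## Sources

* G. Benfatto, A. Giuliani, V. Mastropietro, Ann. Henri Poincaré 7 (2006) 809–898, Lemma 3.1 / App. A2–A3. [BenfattoGiulianiMastropietro2006]
* V. Mastropietro, *Non-Perturbative Renormalization* (World Scientific, 2008), ch. 14, (14.67) p. 223; p. 229. [Mastropietro2008]
-/

noncomputable section

open Real Set

namespace Literature.MathematicalPhysics.QuantumLattice.BandSectorCounting

/-! ## §1 The affine inverse-square-root sums -/

/-- `Σ_{k=1}^{n} 1/√k ≤ 2√n`. [folklore] -/
private theorem sum_Icc_inv_sqrt_le (n : ℕ) : ∑ k ∈ Finset.Icc 1 n, 1 / Real.sqrt k ≤ 2 * Real.sqrt n := by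
  induction n with
  | zero => simp
  | succ n ih =>
    rw [Finset.sum_Icc_succ_top (Nat.le_add_left 1 n)]
    have hn1 : (0 : ℝ) < (n + 1 : ℕ) := by positivity
    have hs1 : 0 < Real.sqrt ((n + 1 : ℕ) : ℝ) := Real.sqrt_pos.2 hn1
    have hs0 : 0 ≤ Real.sqrt (n : ℝ) := Real.sqrt_nonneg _
    -- `1/√(n+1) ≤ 2(√(n+1) − √n)`
    have key : 1 / Real.sqrt ((n + 1 : ℕ) : ℝ) ≤ 2 * Real.sqrt ((n + 1 : ℕ) : ℝ) - 2 * Real.sqrt n := by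
      rw [div_le_iff₀ hs1]
      have e1 : Real.sqrt ((n + 1 : ℕ) : ℝ) * Real.sqrt ((n + 1 : ℕ) : ℝ) = (n : ℝ) + 1 := by
        rw [Real.mul_self_sqrt hn1.le]; push_cast; ring
      have e2 : Real.sqrt (n : ℝ) * Real.sqrt (n : ℝ) = n := Real.mul_self_sqrt (Nat.cast_nonneg n)
      have e3 : Real.sqrt (n : ℝ) ≤ Real.sqrt ((n + 1 : ℕ) : ℝ) := Real.sqrt_le_sqrt (by push_cast; linarith)
      nlinarith [e1, e2, e3, hs0]
    linarith

/-- `Σ_{k<K} 1/√(φ + v·k) ≤ 1/√φ + 2√(K−1)/√v` (`φ, v > 0`; the term `k = 0` and `1/√(v k)` for `k ≥ 1`). [folklore] -/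
private theorem sum_range_inv_sqrt_affine_le {φ v : ℝ} (hφ : 0 < φ) (hv : 0 < v) (K : ℕ) :
    ∑ k ∈ Finset.range K, 1 / Real.sqrt (φ + v * k) ≤ 1 / Real.sqrt φ + 2 * Real.sqrt ((K : ℝ) - 1) / Real.sqrt v := by
  rcases Nat.eq_zero_or_pos K with rfl | hK
  · simp only [Finset.range_zero, Finset.sum_empty, CharP.cast_eq_zero, zero_sub]
    have : Real.sqrt (-1 : ℝ) = 0 := Real.sqrt_eq_zero'.2 (by norm_num)
    rw [this]; simp
  · obtain ⟨n, rfl⟩ : ∃ n, K = n + 1 := ⟨K - 1, by omega⟩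
    rw [Finset.range_eq_Ico, Finset.sum_eq_sum_Ico_succ_bot (by omega)]
    simp only [CharP.cast_eq_zero, mul_zero, add_zero]
    have hsv : 0 < Real.sqrt v := Real.sqrt_pos.2 hv
    have hrest : ∑ k ∈ Finset.Ico 1 (n + 1), 1 / Real.sqrt (φ + v * k) ≤ ∑ k ∈ Finset.Icc 1 n, (1 / Real.sqrt k) / Real.sqrt v := by
      rw [show Finset.Ico 1 (n + 1) = Finset.Icc 1 n from rfl]
      refine Finset.sum_le_sum fun k hk => ?_
      rw [Finset.mem_Icc] at hk
      have hk0 : (0 : ℝ) < k := by exact_mod_cast hk.1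
      rw [div_div, ← Real.sqrt_mul (le_of_lt hk0), one_div_le_one_div (Real.sqrt_pos.2 (by positivity)) (Real.sqrt_pos.2 (by positivity))]
      exact Real.sqrt_le_sqrt (by nlinarith)
    have h2 := sum_Icc_inv_sqrt_le n
    rw [← Finset.sum_div] at hrest
    have h3 : (∑ k ∈ Finset.Icc 1 n, 1 / Real.sqrt k) / Real.sqrt v ≤ 2 * Real.sqrt n / Real.sqrt v :=
      div_le_div_of_nonneg_right h2 hsv.le
    have e : ((n + 1 : ℕ) : ℝ) - 1 = n := by push_cast; ring
    rw [e]
    linarith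

/-- **Rank form.**  If `φ + v·r(i) ≤ a_i` on a finite set `S` of indices with `r` injective on `S` into `{0, …, K−1}`, then
`Σ_{i∈S} 1/√a_i ≤ 1/√φ + 2√(K−1)/√v`. [folklore] -/
private theorem sum_inv_sqrt_le_of_rank (S : Finset ℕ) (a : ℕ → ℝ) (r : ℕ → ℕ) {φ v : ℝ} {K : ℕ} (hφ : 0 < φ) (hv : 0 < v)
    (hinj : Set.InjOn r S) (hrK : ∀ i ∈ S, r i < K) (ha : ∀ i ∈ S, φ + v * r i ≤ a i) :
    ∑ i ∈ S, 1 / Real.sqrt (a i) ≤ 1 / Real.sqrt φ + 2 * Real.sqrt ((K : ℝ) - 1) / Real.sqrt v := by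
  have h1 : ∑ i ∈ S, 1 / Real.sqrt (a i) ≤ ∑ i ∈ S, 1 / Real.sqrt (φ + v * r i) := by
    refine Finset.sum_le_sum fun i hi => ?_
    have hpos : 0 < φ + v * r i := by positivity
    exact one_div_le_one_div_of_le (Real.sqrt_pos.2 hpos) (Real.sqrt_le_sqrt (ha i hi))
  have h2 : ∑ i ∈ S, 1 / Real.sqrt (φ + v * r i) = ∑ k ∈ S.image r, 1 / Real.sqrt (φ + v * k) := by
    rw [Finset.sum_image (fun i hi j hj h => hinj hi hj h)]
  have h3 : ∑ k ∈ S.image r, 1 / Real.sqrt (φ + v * k) ≤ ∑ k ∈ Finset.range K, 1 / Real.sqrt (φ + v * k) := by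
    refine Finset.sum_le_sum_of_subset_of_nonneg ?_ fun k _ _ => by positivity
    intro k hk
    rw [Finset.mem_image] at hk
    obtain ⟨i, hi, rfl⟩ := hk
    exact Finset.mem_range.2 (hrK i hi)
  exact h1.trans (h2.le.trans (h3.trans (sum_range_inv_sqrt_affine_le hφ hv K)))

/-! ## §2 The arcsine sum on a grid -/

section Window

variable {g g' g'' : ℝ → ℝ} (hg : ∀ z, HasDerivAt g (g' z) z) (hg' : ∀ z, HasDerivAt g' (g'' z) z)
  {σc R c₂ : ℝ} (hc₂ : 0 < c₂) (hlo : ∀ z ∈ Icc (σc - R) (σc + R), c₂ ≤ g'' z) (hcrit : g' σc = 0)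
include hg hg' hc₂ hlo hcrit


/-- **The arcsine sum near a convex minimum.**  With `c₂ ≤ g″` on `[σ_c − R, σ_c + R]`, `g′(σ_c) = 0` and `0 < φ`:
`Σ_{i<N : xᵢ ∈ [σ_c − R, σ_c + R], g(xᵢ) ≤ −φ} 1/√|g(xᵢ)| ≤ 4/√φ + 11/(√c₂·h)` on any grid `xᵢ = x₀ + i·h` — uniformly in the critical value
`g(σ_c)` (the discrete arcsine integral of the umklapp-corner rows). [cite: BenfattoGiulianiMastropietro2006, Lemma 3.1 / App. A2–A3] -/
theorem sum_inv_sqrt_near_min_le {φ x₀ h : ℝ} (hφ : 0 < φ) (hh : 0 < h) (N : ℕ) :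
    ∑ i ∈ (Finset.range N).filter (fun i : ℕ => x₀ + i * h ∈ Icc (σc - R) (σc + R) ∧ g (x₀ + i * h) ≤ -φ),
        1 / Real.sqrt |g (x₀ + i * h)| ≤ 4 / Real.sqrt φ + 11 / (Real.sqrt c₂ * h) := by
  set x : ℕ → ℝ := fun i => x₀ + i * h with hxdef
  set I := (Finset.range N).filter (fun i : ℕ => x i ∈ Icc (σc - R) (σc + R) ∧ g (x i) ≤ -φ) with hI
  have hsφ : 0 < Real.sqrt φ := Real.sqrt_pos.2 hφ
  have hsc : 0 < Real.sqrt c₂ := Real.sqrt_pos.2 hc₂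
  have hW0 : 0 ≤ 4 / Real.sqrt φ + 11 / (Real.sqrt c₂ * h) := by positivity
  change ∑ i ∈ I, 1 / Real.sqrt |g (x i)| ≤ _
  rcases I.eq_empty_or_nonempty with hIe | hIne
  · rw [hIe, Finset.sum_empty]; exact hW0
  -- the critical value is `≤ −φ`
  obtain ⟨i₀, hi₀⟩ := hIne
  have hmemI : ∀ i, i ∈ I ↔ i < N ∧ x i ∈ Icc (σc - R) (σc + R) ∧ g (x i) ≤ -φ := fun i => by
    rw [hI, Finset.mem_filter, Finset.mem_range]
  set Dc := g σc with hDc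
  have hDcφ : Dc ≤ -φ := by
    obtain ⟨-, hx, hgx⟩ := (hmemI i₀).1 hi₀
    have := le_of_critical hg hg' hlo hcrit hx
    nlinarith [sq_nonneg (x i₀ - σc)]
  have hDc0 : 0 < -Dc := by linarith
  set v := Real.sqrt (c₂ * (-Dc) / 8) with hv
  have hv0 : 0 < v := Real.sqrt_pos.2 (by positivity)
  -- the three classes
  set Id := I.filter (fun i => g (x i) ≤ Dc / 2) with hId
  set Ir := I.filter (fun i => Dc / 2 < g (x i) ∧ σc < x i) with hIr
  set Il := I.filter (fun i => Dc / 2 < g (x i) ∧ x i < σc) with hIl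
  have hterm0 : ∀ i, 0 ≤ 1 / Real.sqrt |g (x i)| := fun i => by positivity
  have hsplit : ∑ i ∈ I, 1 / Real.sqrt |g (x i)| ≤
      ∑ i ∈ Id, 1 / Real.sqrt |g (x i)| + ∑ i ∈ Ir, 1 / Real.sqrt |g (x i)| + ∑ i ∈ Il, 1 / Real.sqrt |g (x i)| := by
    have eId : ∑ i ∈ Id, 1 / Real.sqrt |g (x i)| = ∑ i ∈ I, (if g (x i) ≤ Dc / 2 then 1 / Real.sqrt |g (x i)| else 0) := by
      rw [hId]; exact Finset.sum_filter _ _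
    have eIr : ∑ i ∈ Ir, 1 / Real.sqrt |g (x i)| = ∑ i ∈ I, (if Dc / 2 < g (x i) ∧ σc < x i then 1 / Real.sqrt |g (x i)| else 0) := by
      rw [hIr]; exact Finset.sum_filter _ _
    have eIl : ∑ i ∈ Il, 1 / Real.sqrt |g (x i)| = ∑ i ∈ I, (if Dc / 2 < g (x i) ∧ x i < σc then 1 / Real.sqrt |g (x i)| else 0) := by
      rw [hIl]; exact Finset.sum_filter _ _
    rw [eId, eIr, eIl, ← Finset.sum_add_distrib, ← Finset.sum_add_distrib]
    refine Finset.sum_le_sum fun i hi => ?_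
    have h0 := hterm0 i
    by_cases hd : g (x i) ≤ Dc / 2
    · rw [if_pos hd]; split_ifs <;> linarith
    · rw [if_neg hd]
      push Not at hd
      rcases lt_trichotomy (x i) σc with hlt | heq | hgt
      · rw [if_neg (fun h => by linarith [h.2]), if_pos ⟨hd, hlt⟩]; linarith
      · exfalso; rw [heq] at hd; linarith
      · rw [if_pos ⟨hd, hgt⟩]; split_ifs <;> linarith
  -- deep rows: at most `2√(|Dc|/c₂)/h + 1` of them, each `≤ √2/√|Dc| ≤ √2/√φ`
  have hdeep : ∑ i ∈ Id, 1 / Real.sqrt |g (x i)| ≤ 2 * Real.sqrt 2 / (Real.sqrt c₂ * h) + Real.sqrt 2 / Real.sqrt φ := by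
    set r := Real.sqrt (-Dc / c₂) with hr
    have hr0 : 0 ≤ r := Real.sqrt_nonneg _
    have hwin : ∀ i ∈ Id, |x i - σc| ≤ r := by
      intro i hi
      rw [hId, Finset.mem_filter] at hi
      obtain ⟨hiI, hd⟩ := hi
      obtain ⟨-, hxI, -⟩ := (hmemI i).1 hiI
      have := le_of_critical hg hg' hlo hcrit hxI
      have hsq : (x i - σc) ^ 2 ≤ -Dc / c₂ := by rw [le_div_iff₀ hc₂]; nlinarith
      calc |x i - σc| = Real.sqrt ((x i - σc) ^ 2) := (Real.sqrt_sq_eq_abs _).symm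
        _ ≤ r := Real.sqrt_le_sqrt hsq
    have hcard : ((Id.card : ℝ)) ≤ 2 * r / h + 1 := by
      refine natCard_le_of_diam (by positivity) fun i hi j hj => ?_
      have h1 := hwin i hi; have h2 := hwin j hj
      have e : ((j : ℝ) - i) * h = (x j - σc) - (x i - σc) := by simp only [hxdef]; ring
      have : ((j : ℝ) - i) * h ≤ 2 * r := by
        rw [e]; have := abs_le.1 h1; have := abs_le.1 h2; linarith
      rw [le_div_iff₀ hh]; exact this
    have hterm : ∀ i ∈ Id, 1 / Real.sqrt |g (x i)| ≤ Real.sqrt 2 / Real.sqrt (-Dc) := by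
      intro i hi
      rw [hId, Finset.mem_filter] at hi
      have hgi : -Dc / 2 ≤ |g (x i)| := by
        have : g (x i) ≤ Dc / 2 := hi.2
        rw [abs_of_nonpos (by linarith)]; linarith
      rw [div_le_div_iff₀ (Real.sqrt_pos.2 (by linarith)) (Real.sqrt_pos.2 hDc0), one_mul, ← Real.sqrt_mul (by norm_num)]
      exact Real.sqrt_le_sqrt (by linarith)
    calc ∑ i ∈ Id, 1 / Real.sqrt |g (x i)| ≤ ∑ i ∈ Id, Real.sqrt 2 / Real.sqrt (-Dc) := Finset.sum_le_sum hterm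
      _ = (Id.card : ℝ) * (Real.sqrt 2 / Real.sqrt (-Dc)) := by rw [Finset.sum_const, nsmul_eq_mul]
      _ ≤ (2 * r / h + 1) * (Real.sqrt 2 / Real.sqrt (-Dc)) := mul_le_mul_of_nonneg_right hcard (by positivity)
      _ = 2 * Real.sqrt 2 / (Real.sqrt c₂ * h) + Real.sqrt 2 / Real.sqrt (-Dc) := by
          rw [hr, Real.sqrt_div' _ hc₂.le]
          field_simp
      _ ≤ _ := by
          have : Real.sqrt 2 / Real.sqrt (-Dc) ≤ Real.sqrt 2 / Real.sqrt φ :=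
            div_le_div_of_nonneg_left (by positivity) hsφ (Real.sqrt_le_sqrt (by linarith))
          linarith
  -- the key facts for the shallow classes: distance to the minimum `≤ x₀' = √(2|Dc|/c₂)` and `x₀'/v = 4/c₂`
  set x₀' := Real.sqrt (2 * (-Dc) / c₂) with hx₀'
  have hdist : ∀ i ∈ I, |x i - σc| ≤ x₀' := by
    intro i hi
    obtain ⟨-, hxI, hgx⟩ := (hmemI i).1 hi
    have hsq := sq_sub_le_of_nonpos_near_min hg hg' hc₂ hlo hcrit hxI (by linarith)
    calc |x i - σc| = Real.sqrt ((x i - σc) ^ 2) := (Real.sqrt_sq_eq_abs _).symm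
      _ ≤ x₀' := Real.sqrt_le_sqrt hsq
  have hxv : x₀' * c₂ = 4 * v := by
    have h1 : 0 ≤ x₀' * c₂ := by positivity
    have h2 : 0 ≤ 4 * v := by positivity
    refine (pow_left_inj₀ h1 h2 two_ne_zero).1 ?_
    rw [mul_pow, mul_pow, hx₀', hv, Real.sq_sqrt (by positivity), Real.sq_sqrt (by positivity)]
    field_simp
    ring
  have hT_eq : 2 * Real.sqrt (x₀' / h) / Real.sqrt (v * h) = 4 / (Real.sqrt c₂ * h) := by
    have h1 : 0 ≤ 2 * Real.sqrt (x₀' / h) / Real.sqrt (v * h) := by positivity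
    have h2 : 0 ≤ 4 / (Real.sqrt c₂ * h) := by positivity
    refine (pow_left_inj₀ h1 h2 two_ne_zero).1 ?_
    rw [div_pow, div_pow, mul_pow, mul_pow, Real.sq_sqrt (by positivity), Real.sq_sqrt (by positivity), Real.sq_sqrt hc₂.le]
    rw [div_eq_div_iff (by positivity) (by positivity)]
    have e1 : (2:ℝ) ^ 2 * (x₀' / h) * (c₂ * h ^ 2) = 4 * (x₀' * c₂) * h := by field_simp; ring
    rw [e1, hxv]; ring
  -- right shallow rows: rank `r i = iM − i`
  have hright : ∑ i ∈ Ir, 1 / Real.sqrt |g (x i)| ≤ 1 / Real.sqrt φ + 4 / (Real.sqrt c₂ * h) := by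
    rcases Ir.eq_empty_or_nonempty with hIe | hIne
    · rw [hIe, Finset.sum_empty]; positivity
    set iM := Ir.max' hIne with hiM
    set im := Ir.min' hIne with him
    have hiMmem : iM ∈ Ir := Finset.max'_mem _ _
    have himmem : im ∈ Ir := Finset.min'_mem _ _
    have hmemIr : ∀ i, i ∈ Ir → (i < N ∧ x i ∈ Icc (σc - R) (σc + R) ∧ g (x i) ≤ -φ) ∧ Dc / 2 < g (x i) ∧ σc < x i := by
      intro i hi; rw [hIr, Finset.mem_filter] at hi; exact ⟨(hmemI i).1 hi.1, hi.2⟩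
    have hK := sum_inv_sqrt_le_of_rank Ir (fun i => |g (x i)|) (fun i => iM - i) (K := iM - im + 1) (v := v * h) hφ
      (by positivity)
      (by
        intro i hi j hj hij
        have hi' := Finset.le_max' Ir i hi; have hj' := Finset.le_max' Ir j hj
        rw [← hiM] at hi' hj'
        simp only at hij; omega)
      (by
        intro i hi
        have := Finset.min'_le Ir i hi; rw [← him] at this; omega)
      (by
        intro i hi
        obtain ⟨⟨-, hxi, hgi⟩, hsi, hσi⟩ := hmemIr i hi
        obtain ⟨⟨-, hxM, hgM⟩, hsM, hσM⟩ := hmemIr iM hiMmem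
        have hle : i ≤ iM := by have := Finset.le_max' Ir i hi; rwa [← hiM] at this
        have hxx : x i ≤ x iM := by
          simp only [hxdef]; have : (i : ℝ) ≤ iM := by exact_mod_cast hle
          nlinarith
        have hch := chain_right hg hg' hc₂ hlo hcrit hσi hxx hxM.2 hsi (by linarith)
        have e : x iM - x i = ((iM - i : ℕ) : ℝ) * h := by
          simp only [hxdef]; rw [Nat.cast_sub hle]; ring
        rw [abs_of_nonpos (by linarith)]
        have hgMφ : φ ≤ -g (x iM) := by linarith
        calc φ + v * h * ((iM - i : ℕ) : ℝ) = φ + v * (x iM - x i) := by rw [e]; ring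
          _ ≤ -g (x i) := by linarith)
    refine hK.trans ?_
    -- `√(K − 1) = √(iM − im) ≤ √(x₀'/h)`
    have hdiam : ((iM - im + 1 : ℕ) : ℝ) - 1 ≤ x₀' / h := by
      have hle : im ≤ iM := by
        have := Finset.min'_le Ir iM hiMmem; rwa [← him] at this
      rw [Nat.cast_add, Nat.cast_sub hle]; push_cast
      have h1 := hdist iM ((Finset.mem_filter.1 (by rw [hIr] at hiMmem; exact hiMmem)).1)
      have h2 := hmemIr im himmem
      have : (x iM - σc) - (x im - σc) ≤ x₀' := by
        have := (abs_le.1 h1).2; linarith [h2.2.2]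
      have e : (x iM - σc) - (x im - σc) = ((iM : ℝ) - im) * h := by simp only [hxdef]; ring
      rw [e] at this
      rw [le_div_iff₀ hh]; linarith
    have hs1 : Real.sqrt (((iM - im + 1 : ℕ) : ℝ) - 1) ≤ Real.sqrt (x₀' / h) := Real.sqrt_le_sqrt hdiam
    have hT := hT_eq
    have : 2 * Real.sqrt (((iM - im + 1 : ℕ) : ℝ) - 1) / Real.sqrt (v * h) ≤ 2 * Real.sqrt (x₀' / h) / Real.sqrt (v * h) :=
      div_le_div_of_nonneg_right (by linarith) (Real.sqrt_nonneg _)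
    linarith
  -- left shallow rows: rank `r i = i − im`
  have hleft : ∑ i ∈ Il, 1 / Real.sqrt |g (x i)| ≤ 1 / Real.sqrt φ + 4 / (Real.sqrt c₂ * h) := by
    rcases Il.eq_empty_or_nonempty with hIe | hIne
    · rw [hIe, Finset.sum_empty]; positivity
    set iM := Il.max' hIne with hiM
    set im := Il.min' hIne with him
    have hiMmem : iM ∈ Il := Finset.max'_mem _ _
    have himmem : im ∈ Il := Finset.min'_mem _ _
    have hmemIl : ∀ i, i ∈ Il → (i < N ∧ x i ∈ Icc (σc - R) (σc + R) ∧ g (x i) ≤ -φ) ∧ Dc / 2 < g (x i) ∧ x i < σc := by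
      intro i hi; rw [hIl, Finset.mem_filter] at hi; exact ⟨(hmemI i).1 hi.1, hi.2⟩
    have hK := sum_inv_sqrt_le_of_rank Il (fun i => |g (x i)|) (fun i => i - im) (K := iM - im + 1) (v := v * h) hφ
      (by positivity)
      (by
        intro i hi j hj hij
        have hi' := Finset.min'_le Il i hi; have hj' := Finset.min'_le Il j hj
        rw [← him] at hi' hj'
        simp only at hij; omega)
      (by
        intro i hi
        have h1 := Finset.le_max' Il i hi; rw [← hiM] at h1
        have h2 := Finset.min'_le Il i hi; rw [← him] at h2
        omega)
      (by
        intro i hi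
        obtain ⟨⟨-, hxi, hgi⟩, hsi, hσi⟩ := hmemIl i hi
        obtain ⟨⟨-, hxm, hgm⟩, hsm, hσm⟩ := hmemIl im himmem
        have hle : im ≤ i := by have := Finset.min'_le Il i hi; rwa [← him] at this
        have hxx : x im ≤ x i := by
          simp only [hxdef]; have : (im : ℝ) ≤ i := by exact_mod_cast hle
          nlinarith
        have hch := chain_left hg hg' hc₂ hlo hcrit hxm.1 hxx hσi (by linarith) hsi
        have e : x i - x im = ((i - im : ℕ) : ℝ) * h := by
          simp only [hxdef]; rw [Nat.cast_sub hle]; ring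
        rw [abs_of_nonpos (by linarith)]
        calc φ + v * h * ((i - im : ℕ) : ℝ) = φ + v * (x i - x im) := by rw [e]; ring
          _ ≤ -g (x i) := by linarith)
    refine hK.trans ?_
    have hdiam : ((iM - im + 1 : ℕ) : ℝ) - 1 ≤ x₀' / h := by
      have hle : im ≤ iM := by
        have := Finset.min'_le Il iM hiMmem; rwa [← him] at this
      rw [Nat.cast_add, Nat.cast_sub hle]; push_cast
      have h1 := hdist im ((Finset.mem_filter.1 (by rw [hIl] at himmem; exact himmem)).1)
      have h2 := hmemIl iM hiMmem
      have : (x iM - σc) - (x im - σc) ≤ x₀' := by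
        have := (abs_le.1 h1).1; linarith [h2.2.2]
      have e : (x iM - σc) - (x im - σc) = ((iM : ℝ) - im) * h := by simp only [hxdef]; ring
      rw [e] at this
      rw [le_div_iff₀ hh]; linarith
    have hs1 : Real.sqrt (((iM - im + 1 : ℕ) : ℝ) - 1) ≤ Real.sqrt (x₀' / h) := Real.sqrt_le_sqrt hdiam
    have hT := hT_eq
    have : 2 * Real.sqrt (((iM - im + 1 : ℕ) : ℝ) - 1) / Real.sqrt (v * h) ≤ 2 * Real.sqrt (x₀' / h) / Real.sqrt (v * h) :=
      div_le_div_of_nonneg_right (by linarith) (Real.sqrt_nonneg _)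
    linarith
  -- total: `(√2 + 2)/√φ + (2√2 + 8)/(√c₂ h) ≤ 4/√φ + 11/(√c₂ h)`
  have hs2 : Real.sqrt 2 ≤ 3 / 2 := by
    rw [show (3:ℝ) / 2 = Real.sqrt ((3/2) ^ 2) by rw [Real.sqrt_sq (by norm_num)]]
    exact Real.sqrt_le_sqrt (by norm_num)
  have hφinv : 0 < 1 / Real.sqrt φ := by positivity
  have hcinv : 0 < 1 / (Real.sqrt c₂ * h) := by positivity
  have e1 : Real.sqrt 2 / Real.sqrt φ = Real.sqrt 2 * (1 / Real.sqrt φ) := by ring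
  have e2 : 2 * Real.sqrt 2 / (Real.sqrt c₂ * h) = 2 * Real.sqrt 2 * (1 / (Real.sqrt c₂ * h)) := by ring
  have e3 : 4 / (Real.sqrt c₂ * h) = 4 * (1 / (Real.sqrt c₂ * h)) := by ring
  have e4 : 4 / Real.sqrt φ = 4 * (1 / Real.sqrt φ) := by ring
  have e5 : 11 / (Real.sqrt c₂ * h) = 11 * (1 / (Real.sqrt c₂ * h)) := by ring
  rw [e1, e2] at hdeep; rw [e3] at hright hleft; rw [e4, e5]
  nlinarith [hsplit, hdeep, hright, hleft, hs2, hφinv, hcinv, Real.sqrt_nonneg 2]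

end Window

end Literature.MathematicalPhysics.QuantumLattice.BandSectorCounting

end
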